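import Summits.HodgeConjecture.HodgeConjecture.Theorems.K2E1bGKCohomologyU21Defs   -- ★ p854739: χ-currency `IsChiPinnedCohUnitary`, `HasChiScalars`
import Literature.NumberTheory.Automorphic.UnitaryGroupArchCharacter                -- ★ `IsUnitaryGlobalization`, `HasUnitaryGlobalization`, `integratedOperator`
import Literature.NumberTheory.Automorphic.ArchimedeanCalculus                       -- ★ `IsArchSmooth`
import HarnessLib

/-!
# K2 ∕ E1b tier 1 · unit U8 «ARCHIMEDEAN PACKET SIGNS» — THEOREMS-SIDE DEFS LEAF (U8-0) of `Cruxes/H413/Lines/K2_E1b_GKCohomologyU21_U8_ArchPacketSigns.lean`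

Cell hodgecm-mathlib, Track B «K2-LIT», engine E1b; crux item h413 = stmt-HodgeConjecture-24833; line author K2E1b-plan (g2); leaf typed by K2E1b-p01 (g3)
(E1b STANDING QUEUE Q1, 2026-09-04T00:03:57Z).  K2-lead RULING R3 (d) «DEFS BEFORE SIGS IS HARD»: no `Theorems/` file may import a `Cruxes/…/Lines` module,
so every `def` ∕ `structure` that the tier-1 socket `sig_K2E1bArchPacketSigns` or a tier-2 prover (U8-2 … U8-9) names must live in a ★ leaf FIRST.  THIS FILE is
that leaf for unit U8: §0 of the line module (ED. 1, commit ac5f67872ed6) VERBATIM — `HasArchOpTrace` + `hasArchOpTrace_iff`, `ArchSignLawAt`, `IsArchTestU21`,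
`IsRegularParam`, `casimirOf`, `centralOf`, `structure DSPacketCarriers` + laws `LawDistinct` ∕ `LawChi` ∕ `LawGlob` ∕ `LawPseudoCoeff`, and the letter
`ArchPacketSignsLetter` — same namespace `…Cruxes.H413.K2E1bGKCohomologyU21.U8`, same imports, docstrings as they stand (definitional ∕ route-posited predicates
carry their sources in plain parentheses, hence untagged; the two ℤ-valued calibrations `casimirOf` ∕ `centralOf` keep their `[cite:]` tags), so that the line
module's ED. 2 imports this leaf and drops its local copies with statement bytes equal (drill of leaf #1 ★ p854739).
Definitions only (+ the `Iff.rfl` unfolding `hasArchOpTrace_iff`); no `sorry`, no axiom, no instance, no notation.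
Sources (audited by the line author against the held pages, R90 = `book:rogawski1990-automorphic-representations-unitary-groups-three-variables`):
[Rogawski1990] §13.8 pp. 218–219 (p0211.txt L11–30, p0212.txt L1–3), §12.3 pp. 176–178 (p0167–p0169), §12.6 p. 187; [ClozelDelorme1984] (invariant Paley–Wiener ⇒
pseudo-coefficients); [Knapp1986] Thm. 10.2 (trace class); [KnappVogan1995] Prop. 4.120; [BorelJacquet1979] §1.1; [GetzHahn2024] §4.8 p. 91.

HONEST LABEL: HC_CM is proved only modulo the 7 printed citations (2 remaining named inputs: hLiu418 = stmt-HodgeConjecture-24832,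
h413 = stmt-HodgeConjecture-24833) until rung 0 closes; this file asserts nothing (definitions only).
-/

set_option autoImplicit false
set_option linter.dupNamespace false

noncomputable section

open NumberField MeasureTheory CompactlySupported
open scoped Matrix MatrixGroups InnerProductSpace ContDiff

namespace Summit.HodgeConjecture.HodgeConjecture.Cruxes.H413.K2E1bGKCohomologyU21.U8

open Literature.NumberTheory.Automorphic
open Literature.RepresentationTheory.KonnoKonno2007 Literature.RepresentationTheory.KonnoKonno2007.RealDualPair
open Summit.HodgeConjecture.HodgeConjecture.Cruxes.H413.K2E1bGKCohomologyU21 (IsChiPinnedCohUnitary)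

/-! ## §0 The definitions of unit U8 (VERBATIM from the line module's §0) -/

section Generic

variable {G : Type*} [Group G] [TopologicalSpace G] [MeasurableSpace G] [BorelSpace G]

/-- **`Θ_ϖ(f) = c` as a trace**: for EVERY Hilbert basis `(e_k)` of the space of the unitary representation `ϖ`, the diagonal sums
`Σ_k ⟪e_k, ϖ(f) e_k⟫` converge (unconditionally, `HasSum`) to `c` — i.e. `ϖ(f)` has the basis-free trace `c`.  Junk-free: no `tsum`, no chosen basis;
for `ϖ` irreducible unitary and `f ∈ C_c^∞` this holds with `c = Θ_ϖ(f)`, Harish-Chandra's distribution character [Knapp1986, Thm. 10.2].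
Stated for any topological group `G` and any measure finite on compacta (so E1 may use it on `H(ℝ)` as well).
(Knapp1986, Thm. 10.2) (GetzHahn2024, §4.8 p. 91) — a definitional predicate of the engine line, not a result of the literature (hence untagged). -/
def HasArchOpTrace (ν : Measure G) [IsFiniteMeasureOnCompacts ν] {E : Type} [NormedAddCommGroup E] [InnerProductSpace ℂ E] [CompleteSpace E]
    (ϖ : ContRepresentation ℂ G E) (hu : ϖ.IsUnitary) (hsc : ϖ.IsStronglyContinuous) (f : C_c(G, ℂ)) (c : ℂ) : Prop :=
  ∀ (κ : Type) (b : HilbertBasis κ ℂ E), HasSum (fun k : κ => ⟪(b k : E), ϖ.integratedOperator hu hsc ν f (b k)⟫_ℂ) c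

/-- Unfolding `HasArchOpTrace`. (Knapp1986, Thm. 10.2) -/
theorem hasArchOpTrace_iff (ν : Measure G) [IsFiniteMeasureOnCompacts ν] {E : Type} [NormedAddCommGroup E]
    [InnerProductSpace ℂ E] [CompleteSpace E] (ϖ : ContRepresentation ℂ G E) (hu : ϖ.IsUnitary) (hsc : ϖ.IsStronglyContinuous)
    (f : C_c(G, ℂ)) (c : ℂ) :
    HasArchOpTrace ν ϖ hu hsc f c ↔
      ∀ (κ : Type) (b : HilbertBasis κ ℂ E), HasSum (fun k : κ => ⟪(b k : E), ϖ.integratedOperator hu hsc ν f (b k)⟫_ℂ) c := Iff.rfl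

/-- **The archimedean sign law at one real place** (the shape engine E1 binds as `hArchSign`): for EVERY irreducible unitary representation `ϖ` of
`G`, `Θ_ϖ(f₁) ∈ {0, 1}` and `Θ_ϖ(f_u) ∈ {0, 1, −1}` — print's «Tr(π_1v(f_v)) = 1 and Tr(π(f_v)) = 0 for π ≠ π_1v», «Tr(π_ju(f_u)) = (−1)^{j+1} for
j = 1, 2 and Tr(π(f_u)) = 0 for irreducible π ≠ π_1u, π_2u» [Rogawski1990, §13.8 p. 218], hence «ε_π = ±1» (p. 219 L3).
(Rogawski1990, §13.8 pp. 218–219) — a route-posited predicate of the engine line, not a result of the literature (hence untagged). -/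
def ArchSignLawAt (ν : Measure G) [IsFiniteMeasureOnCompacts ν] (f₁ fu : C_c(G, ℂ)) : Prop :=
  ∀ (E : Type) [NormedAddCommGroup E] [InnerProductSpace ℂ E] [CompleteSpace E] (ϖ : ContRepresentation ℂ G E)
    (hu : ϖ.IsUnitary) (hsc : ϖ.IsStronglyContinuous), ϖ.IsTopIrreducible →
      (HasArchOpTrace ν ϖ hu hsc f₁ 0 ∨ HasArchOpTrace ν ϖ hu hsc f₁ 1) ∧
        (HasArchOpTrace ν ϖ hu hsc fu 0 ∨ HasArchOpTrace ν ϖ hu hsc fu 1 ∨ HasArchOpTrace ν ϖ hu hsc fu (-1))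

end Generic

/-- **Smooth compactly supported test functions on the real group `U(2,1)`**: `f ∈ C_c(U(2,1))` smooth in the archimedean variable
(`X ↦ f (g · exp X)` is `C^∞` on `𝔲(2,1)`, ★ `IsArchSmooth` along the identity of `U(2,1)`).  (BorelJacquet1979, §1.1) (Knapp1986, Thm. 10.2)
— a definitional predicate (hence untagged). -/
def IsArchTestU21 (f : C_c(↥(uFormGroup (Fin 2) (Fin 1)).carrier, ℂ)) : Prop :=
  IsArchSmooth (H := uFormGroup (Fin 2) (Fin 1)) (MonoidHom.id ↥(uFormGroup (Fin 2) (Fin 1)).carrier) (⇑f)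

/-- **Regular parameters** `φ = φ(a,b,c)` with `m = a − b ≥ 2` and `n = b − c ≥ 2`: then `J_φ^±` are NOT unitary («J_φ^+ unitary iff n = 1, J_φ^− unitary
iff m = 1» [W]) and `F_φ` is not one-dimensional, so the unitary dual at the infinitesimal character of `F_φ` is the discrete-series packet
`{D_φ, D_φ^+, D_φ^−}` — the reading of print's «ρ is chosen so that Π(ρ_v) is integrable» that the sign argument uses.
(Rogawski1990, §12.3 p. 176; §13.8 p. 218) — a definitional predicate (hence untagged). -/
def IsRegularParam (a b c : ℤ) : Prop :=
  b + 2 ≤ a ∧ c + 2 ≤ b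

/-- **Casimir exponent of `F_{φ(a,b,c)}`**: `κ = a² + b² + c² − 2` (`⟨Λ,Λ⟩ − ⟨ρ,ρ⟩`, `Λ = (a,b,c)`, `ρ = (1,0,−1)`; same calibration as tier 0's
`casimirExp = κ ∘ rogTriple`). [cite: Rogawski1990, §12.3 p. 177] [cite: KnappVogan1995, Prop. 4.120] -/
def casimirOf (a b c : ℤ) : ℤ :=
  a ^ 2 + b ^ 2 + c ^ 2 - 2

/-- **Central exponent of `F_{φ(a,b,c)}`**: `e = a + b + c` (tier 0's `centralExp = e ∘ rogTriple`). [cite: Rogawski1990, §12.3 pp. 176–177] -/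
def centralOf (a b c : ℤ) : ℤ :=
  a + b + c

/-- **The posited carrier table of the discrete-series L-packets `Π(φ(a,b,c)) = {D_φ, D_φ^+, D_φ^−}` of `U(2,1)`** (DATA ONLY; index `0 ↦ D_φ`,
`1 ↦ D_φ^+`, `2 ↦ D_φ^−`, the column order of the sign table ★ `Ch12Sec3Defs.pairDS`).  Laws are the named predicates below; existence with the
laws is the socket `sig_K2E1bArchPacketSigns`; identity-level pins (Kovačević quadrant data, lowest `K`-types) are LEVEL B (U8-3…U8-6).
CONSUMER CAVEAT (K2E1b-r01 (g3) box N1): the Level-A laws do NOT pin `cls a b c` to `Π(φ(a,b,c))` — regular packets collide in `(κ, e)` — so nobody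
may read `T.cls a b c` as «the» packet of `φ(a,b,c)` until LEVEL B lands or the HELD Prop. 12.3.2 row H-1 joins the same `∃`; `exists_archSignLaw`
needs only SOME regular discrete-series triple with pseudo-coefficients, which is what E1 consumes (E1 CHOOSES `ρ_v`).
(Rogawski1990, §12.3 pp. 176–178) — a route-posited interface of the engine line, not a result of the literature (hence untagged). -/
structure DSPacketCarriers where
  /-- `cls a b c j` = the `(𝔤,K)`-class of the `j`-th member of `Π(φ(a,b,c))`, `j = 0,1,2 ↦ D_φ, D_φ^+, D_φ^−`. -/
  cls : ℤ → ℤ → ℤ → Fin 3 → GKIrrClass (uFormGroup (Fin 2) (Fin 1))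

namespace DSPacketCarriers

/-- LAW «three distinct members» at regular parameters («ρ, ρ⁺ and ρ⁻ are distinct iff mn ≠ 0 iff Π is square-integrable»).
(Rogawski1990, §12.3 p. 178) — route-posited law (untagged). -/
def LawDistinct (T : DSPacketCarriers) : Prop :=
  ∀ a b c : ℤ, IsRegularParam a b c → Function.Injective (T.cls a b c)

/-- LAW «χ-pinned coh-unitary»: each member is an irreducible admissible `(𝔲(2,1),K)`-module unitary along `𝔭 ⊕ ℝz₀` with the χ-scalars
`(κ, e)(a,b,c)` of `F_φ` (tier 0's currency ★ `IsChiPinnedCohUnitary`). (Rogawski1990, §12.3 p. 177) — route-posited law (untagged). -/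
def LawChi (T : DSPacketCarriers) : Prop :=
  ∀ a b c : ℤ, IsRegularParam a b c → ∀ j : Fin 3, IsChiPinnedCohUnitary (T.cls a b c j) (casimirOf a b c) (centralOf a b c)

/-- LAW «unitary globalization»: each member has a unitary Hilbert globalization (it is a discrete-series representation).
(Rogawski1990, §12.3 p. 178 «Π is square-integrable») (KnappVogan1995, §II.4) — route-posited law (untagged). -/
def LawGlob (T : DSPacketCarriers) : Prop :=
  ∀ a b c : ℤ, IsRegularParam a b c → ∀ j : Fin 3, HasUnitaryGlobalization (uFormGroup (Fin 2) (Fin 1)) (T.cls a b c j)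

/-- LAW «PSEUDO-COEFFICIENTS» at the real place with Haar measure `ν`: for regular `(a,b,c)` there are smooth compactly supported `f_0, f_1, f_2` on
`U(2,1)` with `Θ_{D_i}(f_j) = δ_{ij}` on every unitary globalization of the members and `Θ_ϖ(f_j) = 0` for every irreducible unitary `ϖ` that
globalizes NO member («Let f_jv be a pseudo-coefficient for π_jv … Tr(π(f_v)) = 0 for π ≠ π_1v»).
(Rogawski1990, §13.8 p. 218) (ClozelDelorme1984, invariant Paley–Wiener ⇒ pseudo-coefficients; Rogawski1990, §12.6 p. 187) — route-posited law (untagged). -/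
def LawPseudoCoeff (T : DSPacketCarriers) [MeasurableSpace ↥(uFormGroup (Fin 2) (Fin 1)).carrier]
    [BorelSpace ↥(uFormGroup (Fin 2) (Fin 1)).carrier] (ν : Measure ↥(uFormGroup (Fin 2) (Fin 1)).carrier) [IsFiniteMeasureOnCompacts ν] : Prop :=
  ∀ a b c : ℤ, IsRegularParam a b c →
    ∃ f : Fin 3 → C_c(↥(uFormGroup (Fin 2) (Fin 1)).carrier, ℂ),
      (∀ j, IsArchTestU21 (f j)) ∧
      (∀ (i j : Fin 3) (E : Type) [NormedAddCommGroup E] [InnerProductSpace ℂ E] [CompleteSpace E]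
          (ϖ : ContRepresentation ℂ ↥(uFormGroup (Fin 2) (Fin 1)).carrier E)
          (hϖ : IsUnitaryGlobalization (uFormGroup (Fin 2) (Fin 1)) (T.cls a b c i) ϖ),
          HasArchOpTrace ν ϖ hϖ.isUnitary hϖ.isStronglyContinuous (f j) (if i = j then 1 else 0)) ∧
      (∀ (E : Type) [NormedAddCommGroup E] [InnerProductSpace ℂ E] [CompleteSpace E]
          (ϖ : ContRepresentation ℂ ↥(uFormGroup (Fin 2) (Fin 1)).carrier E) (hu : ϖ.IsUnitary) (hsc : ϖ.IsStronglyContinuous),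
          ϖ.IsTopIrreducible → (∀ i : Fin 3, ¬ IsUnitaryGlobalization (uFormGroup (Fin 2) (Fin 1)) (T.cls a b c i) ϖ) →
            ∀ j : Fin 3, HasArchOpTrace ν ϖ hu hsc (f j) 0)

end DSPacketCarriers

/-- **THE LETTER (E1b, unit U8) — archimedean packet carriers with pseudo-coefficients.**  There is a carrier table of the regular discrete-series
L-packets of `U(2,1)` — distinct, χ-pinned coh-unitary, with unitary globalizations — admitting pseudo-coefficients at every real place (every Borel
structure and Haar measure `ν` on `U(2,1)`).  (Rogawski1990, §13.8 p. 218; §12.3 pp. 176–178) (ClozelDelorme1984, invariant Paley–Wiener ⇒ pseudo-coefficients; Rogawski1990, §12.6 p. 187) (Knapp1986, Thm. 10.2)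
— a route-posited statement of the engine line, not a result of the literature (hence untagged). -/
def ArchPacketSignsLetter : Prop :=
  ∃ T : DSPacketCarriers, T.LawDistinct ∧ T.LawChi ∧ T.LawGlob ∧
    ∀ [MeasurableSpace ↥(uFormGroup (Fin 2) (Fin 1)).carrier] [BorelSpace ↥(uFormGroup (Fin 2) (Fin 1)).carrier]
      (ν : Measure ↥(uFormGroup (Fin 2) (Fin 1)).carrier) [ν.IsHaarMeasure], T.LawPseudoCoeff ν

end Summit.HodgeConjecture.HodgeConjecture.Cruxes.H413.K2E1bGKCohomologyU21.U8

end
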